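import Literature.Probability.Percolation.CutBlocksWallFace
import Literature.Probability.Percolation.LatticeSymIsometry
import HarnessLib

/-!
# Wall faces of the zones of a cut: the face columns, clean windows and the far distance

Topic `Probability/Percolation`.  Support file (definitions and proofs, no named fact) for the named
fact `SchrammSmirnov2011_thm_1_7` (the landing count of the proof of Prop. 4.1, Ann. Probab. 39
(2011), §4): the two hypotheses of the face bound `real_badFace_le` for the upper wall faces of
`CutBlocks.zones` in the frame `downShift`.  The FACE COLUMNS of the block `z` are
`[faceA, faceB] = [⌊s z₁/δ⌋ + 1, ⌈s (z₁+1)/δ⌉ - 1]` (strictly inside the block); every window whose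
box fits in the face columns is clean (`cleanWindow_of_wallFace_fit`, from
`cleanWindow_of_wallFace`, for `8 δ ≤ s`), and every far site is at mesh-`1` distance
`≥ s/δ - 1` from every site of the first collar row over the face (`le_dist_far_face`: the site
below is a tube site, far sites are at distance `≥ s` from the tube, `CutBlocks.le_dist_of_mem_Far`).

## References

* O. Schramm, S. Smirnov, *On the scaling limits of planar percolation*, Ann. Probab. 39 (2011)
  1768–1814, arXiv:1101.5820, §4, proof of Prop. 4.1. [SchrammSmirnov2011]
-/

noncomputable section

open Set Metric
open Literature.Probability.LatticeModels

namespace Literature.Probability.Percolation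

namespace CutBlocks

variable {s : ℝ} {α : Set ℂ} {δ : ℝ}

/-- The first face column of the blocks of column `z₁`. [folklore] -/
def faceA (s δ : ℝ) (z₁ : ℤ) : ℤ := ⌊s * z₁ / δ⌋ + 1

/-- The last face column of the blocks of column `z₁`. [folklore] -/
def faceB (s δ : ℝ) (z₁ : ℤ) : ℤ := ⌈s * (z₁ + 1) / δ⌉ - 1

/-- The face columns lie strictly inside the block. [folklore] -/
theorem faceA_spec (hδ : 0 < δ) (z₁ : ℤ) : s * z₁ < δ * faceA s δ z₁ := by
  rw [faceA]
  have := Int.lt_floor_add_one (s * z₁ / δ)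
  rw [div_lt_iff₀ hδ] at this
  push_cast; linarith

/-- The face columns lie strictly inside the block. [folklore] -/
theorem faceB_spec (hδ : 0 < δ) (z₁ : ℤ) : δ * faceB s δ z₁ < s * (z₁ + 1) := by
  rw [faceB]
  have h := Int.ceil_lt_add_one (s * (z₁ + 1) / δ)
  have h' : ((⌈s * (z₁ + 1) / δ⌉ : ℝ) - 1) * δ < s * (z₁ + 1) := by
    rw [← lt_div_iff₀ hδ]; linarith
  push_cast; linarith

/-- The face is shorter than the block: `δ (faceB - faceA) < s`. [folklore] -/
theorem faceB_sub_faceA_lt (hδ : 0 < δ) (z₁ : ℤ) : δ * (faceB s δ z₁ - faceA s δ z₁) < s := by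
  have h1 := faceA_spec (s := s) hδ z₁
  have h2 := faceB_spec (s := s) hδ z₁
  nlinarith

/-- **Every window fitting in the face columns is clean** (upper faces, `8 δ ≤ s`).
[cite: SchrammSmirnov2011, §4, proof of Prop. 4.1] -/
theorem cleanWindow_of_wallFace_fit (hs : 0 < s) (hδ : 0 < δ) (hα : Bornology.IsBounded α) (h8 : 8 * δ ≤ s)
    {z : ℤ × ℤ} (hz : WallFace s α z) {j : ℤ} {m R₁ : ℕ} (h1 : faceA s δ z.1 ≤ j - R₁ - 2)
    (h2 : j + m + R₁ + 2 ≤ faceB s δ z.1) :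
    ((zones hs hδ hα).collar.map (downShift s δ z.2)).CleanWindow j m R₁ := by
  have hA := faceA_spec (s := s) hδ z.1
  have hB := faceB_spec (s := s) hδ z.1
  have hAB := faceB_sub_faceA_lt (s := s) hδ z.1
  refine cleanWindow_of_wallFace hs hδ hα hz ?_ ?_ (by linarith) ?_
  · have : δ * (faceA s δ z.1 : ℝ) ≤ δ * ((j : ℝ) - R₁ - 2) := mul_le_mul_of_nonneg_left (by exact_mod_cast h1) hδ.le
    linarith
  · have : δ * ((j : ℝ) + m + R₁ + 2) ≤ δ * (faceB s δ z.1 : ℝ) := mul_le_mul_of_nonneg_left (by exact_mod_cast h2) hδ.le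
    linarith
  · -- `δ (R₁ + 4) ≤ δ (faceB - faceA) < s`
    have h3 : (R₁ : ℝ) + 4 ≤ (faceB s δ z.1 : ℝ) - faceA s δ z.1 := by
      have : (R₁ : ℤ) + 4 ≤ faceB s δ z.1 - faceA s δ z.1 := by omega
      exact_mod_cast this
    have := mul_le_mul_of_nonneg_left h3 hδ.le
    linarith

/-- The site below a site of the first collar row over the face is a tube site. [folklore] -/
theorem mem_Nset_below_firstRow (hδ : 0 < δ) (hδs : δ ≤ s) {z : ℤ × ℤ} (hz : WallFace s α z)
    {x : ℤ} (h1 : faceA s δ z.1 ≤ x) (h2 : x ≤ faceB s δ z.1) :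
    (![x, firstRow s δ z.2 - 1] : Site 2) ∈ Nset s α δ := by
  have hA := faceA_spec (s := s) hδ z.1
  have hB := faceB_spec (s := s) hδ z.1
  have hx1 : δ * (faceA s δ z.1 : ℝ) ≤ δ * (x : ℝ) := mul_le_mul_of_nonneg_left (by exact_mod_cast h1) hδ.le
  have hx2 : δ * (x : ℝ) ≤ δ * (faceB s δ z.1 : ℝ) := mul_le_mul_of_nonneg_left (by exact_mod_cast h2) hδ.le
  have hr1 : (⌊s * (z.2 + 1) / δ⌋ : ℝ) ≤ s * (z.2 + 1) / δ := Int.floor_le _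
  have hr2 : s * (z.2 + 1) / δ < (⌊s * (z.2 + 1) / δ⌋ : ℝ) + 1 := Int.lt_floor_add_one _
  rw [le_div_iff₀ hδ] at hr1
  rw [div_lt_iff₀ hδ] at hr2
  refine mem_Nset_of_wallFace hz ?_ ?_ ?_ ?_
  · simp only [Matrix.cons_val_zero]; linarith
  · simp only [Matrix.cons_val_zero]; linarith
  · simp only [Matrix.cons_val_one, firstRow]; push_cast; nlinarith
  · simp only [Matrix.cons_val_one, firstRow]; push_cast; nlinarith

/-- **Far sites are at mesh-`1` distance `≥ s/δ - 1` from the first collar row over a face**, in the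
frame `downShift` (whose boundary row is that collar row). [cite: SchrammSmirnov2011, §4, proof of Prop. 4.1 (β is at distance s from α)] -/
theorem le_dist_far_face (hs : 0 < s) (hδ : 0 < δ) (hδs : δ ≤ s) (hα : Bornology.IsBounded α) {z : ℤ × ℤ}
    (hz : WallFace s α z) {u : Site 2} (hu : u ∈ (zones hs hδ hα).Far) {x : ℤ} (h1 : faceA s δ z.1 ≤ x)
    (h2 : x ≤ faceB s δ z.1) :
    s / δ - 1 ≤ dist (meshPoint 1 ((downShift s δ z.2).σ u)) (meshPoint 1 ![x, 0]) := by
  set r₀ := firstRow s δ z.2 with hr₀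
  -- the frame is an isometry, and `σ (x, r₀) = (x, 0)`
  have hσ : (downShift s δ z.2).σ ![x, r₀] = ![x, 0] := by
    rw [downShift_apply]; funext k; fin_cases k <;> simp [hr₀]
  rw [← hσ, show downShift s δ z.2 = Seeded.LatticeSym.shift (Pi.single 1 (-firstRow s δ z.2)) from rfl,
    (Seeded.LatticeSym.isIsometric_shift _).dist_meshPoint 1 u ![x, r₀]]
  -- the site below is a tube site, at distance `≥ s/δ` from `u`
  have hn := mem_Nset_below_firstRow hδ hδs hz h1 h2
  have hfar := le_dist_of_mem_Far hs hδ hα hu ((mem_zones_N hs hδ hα).2 hn)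
  rw [Seeded.LatticeSym.dist_meshPoint_eq_mul δ, abs_of_pos hδ] at hfar
  have hfar' : s / δ ≤ dist (meshPoint 1 u) (meshPoint 1 ![x, firstRow s δ z.2 - 1]) := by
    rw [div_le_iff₀' hδ]; exact hfar
  -- the two row sites are at distance `1`
  have hadj : dist (meshPoint 1 (![x, firstRow s δ z.2 - 1] : Site 2)) (meshPoint 1 ![x, r₀]) = 1 := by
    rw [Seeded.LatticeSym.dist_meshPoint_eq, abs_one, one_mul]
    simp [hr₀]
  linarith [dist_triangle (meshPoint 1 u) (meshPoint 1 ![x, r₀]) (meshPoint 1 (![x, firstRow s δ z.2 - 1] : Site 2)),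
    dist_comm (meshPoint 1 (![x, firstRow s δ z.2 - 1] : Site 2)) (meshPoint 1 ![x, r₀])]

end CutBlocks

end Literature.Probability.Percolation

end
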